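import Summits.Ventures.HodgeRepro2.T5SU11SphericalIntegral
import Summits.Ventures.HodgeRepro2.T5SU11KProjection

/-!
# The Cartan projection `t(g) = arsinh |g₀₁|` in closed form: `cosh t(g) = |a|`, `sinh t(g) = |b|`, `tanh t(g) = |g·0|`

The Cartan decomposition `g = rot u · a_t · rot v`, `t ≥ 0` (`T5SU11Cartan.exists_cartan`) has a
CANONICAL `A⁺`-component: `cartanT g := arsinh |g₀₁|` (the rotations `u, v` are not canonical). This
file records its closed forms and invariances: `cosh (cartanT g) = |a|`, `sinh (cartanT g) = |b|` for
`g = su11 a b` (`cosh_cartanT`, `sinh_cartanT`), `tanh (cartanT g) = |g·0|` (`tanh_cartanT`) and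
`cosh (cartanT g)^{-2} = 1 - |g·0|²` (`inv_cosh_cartanT_sq`: the «`cosh(η/2)^{-2} = 1 - |g·0|²`» of the
lane with `η = 2 t`), `g = rot u · a_{cartanT g} · rot v` for some `u, v` (`exists_cartan_eq`), the
bi-`K`-invariance `cartanT (rot u · g · rot v) = cartanT g` (`cartanT_rot_mul_rot`), the inversion
invariance `cartanT g⁻¹ = cartanT g`, `cartanT (a_t) = |t|`, and `cartanT g = 0 ↔ g ∈ K`
(`cartanT_eq_zero_iff`). Nothing is claimed about (N).

Blind lane: Mathlib + the HodgeRepro2 prefix only; no sorry; axioms ⊆ {propext, Classical.choice,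
Quot.sound}.
-/

namespace Summit.Ventures.HodgeRepro2.T5SU11CartanProjection

open Metric Set Complex
open T5PoincareDensity T5SU11Unimodular T5SU11Fibration T5SU11Cartan T5SU11OneParameter
  T5BergmanCoefficient T5SU11SphericalIntegral T5SU11KProjection

/-- **The Cartan projection** `t(g) = arsinh |g₀₁| ≥ 0`: the `A⁺`-component of `g = rot u · a_t · rot v`. -/
noncomputable def cartanT (g : SU11) : ℝ := Real.arsinh ‖mat g 0 1‖

/-- `cartanT g ≥ 0`. -/
lemma cartanT_nonneg (g : SU11) : 0 ≤ cartanT g := Real.arsinh_nonneg_iff.mpr (norm_nonneg _)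

/-- `sinh (cartanT g) = |b|` for `g = su11 a b`. -/
theorem sinh_cartanT (g : SU11) : Real.sinh (cartanT g) = ‖mat g 0 1‖ := Real.sinh_arsinh _

/-- `cosh (cartanT g) = |a|` for `g = su11 a b` (`|a|² = 1 + |b|²`). -/
theorem cosh_cartanT (g : SU11) : Real.cosh (cartanT g) = ‖mat g 0 0‖ := by
  have hab : Complex.normSq (mat g 0 0) - Complex.normSq (mat g 0 1) = 1 := normSq_sub_normSq g
  rw [cartanT, Real.cosh_arsinh, ← Complex.normSq_eq_norm_sq,
    show Complex.normSq (mat g 0 1) = Complex.normSq (mat g 0 0) - 1 by linarith,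
    show (1 : ℝ) + (Complex.normSq (mat g 0 0) - 1) = Complex.normSq (mat g 0 0) by ring,
    Complex.normSq_eq_norm_sq, Real.sqrt_sq (norm_nonneg _)]

/-- **`g = rot u · a_{cartanT g} · rot v`** for some rotations `u, v`. -/
theorem exists_cartan_eq (g : SU11) : ∃ u v : Circle, g = rot u * hyp (cartanT g) * rot v := by
  obtain ⟨u, v, t, ht, hg⟩ := exists_cartan g
  have h1 : cartanT g = t := by
    rw [cartanT, hg, norm_mat_zero_one_cartan u v ht, Real.arsinh_sinh]
  exact ⟨u, v, by rw [h1]; exact hg⟩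

/-- **`cartanT` is bi-`K`-invariant**: `cartanT (rot u · g · rot v) = cartanT g`. -/
theorem cartanT_rot_mul_rot (u v : Circle) (g : SU11) : cartanT (rot u * g * rot v) = cartanT g := by
  unfold cartanT
  rw [mat_rot_mul_mul_rot]
  show Real.arsinh ‖(u : ℂ) * (starRingEnd ℂ) (v : ℂ) * mat g 0 1‖ = _
  rw [norm_mul, norm_mul, Circle.norm_coe, Complex.norm_conj, Circle.norm_coe, one_mul, one_mul]

/-- `cartanT (a_t) = |t|`. -/
theorem cartanT_hyp (t : ℝ) : cartanT (hyp t) = |t| := by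
  unfold cartanT
  rw [show mat (hyp t) 0 1 = (Real.sinh t : ℂ) from by rw [mat_hyp]; rfl, Complex.norm_real,
    Real.norm_eq_abs, Real.abs_sinh, Real.arsinh_sinh]

/-- `cartanT (a_t) = t` for `t ≥ 0`. -/
theorem cartanT_hyp_of_nonneg {t : ℝ} (ht : 0 ≤ t) : cartanT (hyp t) = t := by
  rw [cartanT_hyp, abs_of_nonneg ht]

/-- `cartanT (rot u) = 0`. -/
theorem cartanT_rot (u : Circle) : cartanT (rot u) = 0 := by
  unfold cartanT
  rw [show mat (rot u) 0 1 = 0 from by rw [show mat (rot u) = su11 (u : ℂ) 0 from coe_rot u]; rfl,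
    norm_zero, Real.arsinh_zero]

/-- **`cartanT g = 0 ↔ g ∈ K`**. -/
theorem cartanT_eq_zero_iff (g : SU11) : cartanT g = 0 ↔ ∃ u : Circle, g = rot u := by
  constructor
  · intro h
    obtain ⟨u, v, hg⟩ := exists_cartan_eq g
    rw [h, hyp_zero, mul_one, ← map_mul] at hg
    exact ⟨u * v, hg⟩
  · rintro ⟨u, rfl⟩
    exact cartanT_rot u

/-- `cartanT g⁻¹ = cartanT g` (`(g⁻¹)₀₁ = -b`). -/
theorem cartanT_inv (g : SU11) : cartanT g⁻¹ = cartanT g := by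
  unfold cartanT
  rw [mat_inv]
  show Real.arsinh ‖-(mat g 0 1)‖ = _
  rw [norm_neg]

/-- **`tanh (cartanT g) = |g·0|`**: the Cartan parameter is the hyperbolic radius of the orbit point. -/
theorem tanh_cartanT (g : SU11) : Real.tanh (cartanT g) = ‖orbit g‖ := by
  rw [Real.tanh_eq_sinh_div_cosh, sinh_cartanT, cosh_cartanT, orbit_eq, norm_div, Complex.norm_conj]

/-- **`cosh (cartanT g)^{-2} = 1 - |g·0|²`** — the lane's `cosh(η/2)^{-2} = 1 - |g·0|²` with `η = 2 t(g)`. -/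
theorem inv_cosh_cartanT_sq (g : SU11) : (Real.cosh (cartanT g))⁻¹ ^ 2 = 1 - ‖orbit g‖ ^ 2 := by
  rw [cosh_cartanT, one_sub_norm_orbit_sq]

/-- `cartanT` is continuous. -/
theorem continuous_cartanT : Continuous cartanT :=
  Real.continuous_arsinh.comp (T5SU11BorelHaarMeasure.continuous_mat_zero_one.norm)

end Summit.Ventures.HodgeRepro2.T5SU11CartanProjection
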